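import Literature.Computability.Complexity.KnapsackSosDegree
import HarnessLib

/-!
# Grigoriev's isotypic eigenvalue of the knapsack moment form, by name (Grigoriev 2001, eq. (2.16))

Source: D. Grigoriev, *Complexity of Positivstellensatz proofs for the knapsack*, comput. complexity 10
(2001) 139–154 [Grigoriev2001] (held: `paper:doi-10-1007-s00037-001-8192-0`; PDF pages as locators), §2
"Non-negativity of the quadratic form `Q`" (PDF pp. 8–16): the kernel of `Q_l` is the knapsack-ideal part,
the eigenspaces are generated by the *harmonic* coefficient vectors `u ∈ P_{k}^{(0)}`
("`(u_J) : ∀ |I| = k − 1, Σ_{J ⊇ I} u_J = 0`", PDF p. 9) pushed up the inclusion ladder, the eigenvalue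
"depends only on `k` and does not depend on a particular vector `u`" (PDF p. 15), and its value is the
iterated difference `B^{(k)}_k` of the moments `B_i = r(r−1)⋯(r−i+1)/(n(n−1)⋯(n−i+1))`, given in closed
PRODUCT form by eq. (2.16) (PDF p. 16) and positive for `k − 1 < r < n − k + 1` (Lemma 1.4).

The same scalar is the top coefficient of Blekherman's decomposition of the symmetrisation of a square,
T. Lee, A. Prakash, R. de Wolf, H. Yuen, CCC 2016, arXiv:1601.02311 [LeePrakashDewolfYuen2016], Thm. 2.4
(p. 7: "`f̃(z) = q_d(z) + z(n−z) q_{d−1}(z) + ⋯ + z(z−1)⋯(z−d+1)(n−z)(n−1−z)⋯(n−d+1−z) q_0(z)`") and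
App. C (p. 23, Grigoriev's bound re-derived: "`G_r(p) = Sym^{uni}(p)(r)`"), which is the route by which the
tree PROVED Lemma 1.4 (`Grigoriev2001_knapsackFormNonneg_holds`, file `KnapsackSosDegree.lean`): there the
knapsack form of a harmonic (Johnson-ladder) decomposition `h = Σ_{t,d} (Wᵀ)^d p_{t,d}` is identified, as a
polynomial in `r`, with `Σ_t c_t(r) · ‖Σ_d ff(r − t, d) p_{t,d}‖²`, `c_t = slicePoly n t =
((n−2t)!/n!) Π_{i<t} (r − i)(n − i − r)` (`KnapsackFormNonnegProof.formPoly_eq_sosPoly`).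

WHAT IS HERE (all PROVED, no definitions, no facts): the single-ladder specialisation of that identity,
i.e. Grigoriev's eigen-data BY NAME —
* `knapsackForm_iterate_up_of_isHarmonic`: for `p` harmonic of degree `t` and `2(t + d) ≤ n`,
  `Q((Wᵀ)^d p) = c_t(r) · ff(r − t, d)² · ⟪p, p⟫` (the form on Grigoriev's subspace `C_{t+d−1}⋯C_t P^{(0)}_t`);
* `knapsackForm_of_isHarmonic`: for `p` harmonic of degree `k`, `2k ≤ n`,
  `Q(p) = c_k(r) · ⟪p, p⟫`, with `c_k(r) = (slicePoly n k).eval r = ((n−2k)!/n!)·(r)_k (n−r)_k`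
  (`knapsackForm_of_isHarmonic_eq_prod`) `= B_k(r; n) · B_k(n − r; n − k)` in the moments' own currency
  (`knapsackForm_of_isHarmonic_eq_knapsackMoment`): THE ISOTYPIC EIGENVALUE (2.16) of `Q` on the
  degree-`k` harmonic space `V_k ≅ S^{(n−k,k)}` relative to the coefficient inner product;
* `knapsackForm_pos_of_isHarmonic`: it is STRICTLY positive in Grigoriev's window `k − 1 < r < n − k + 1`
  (`p ≠ 0`) — the non-degeneracy of `Q_l` modulo the knapsack ideal (PDF p. 16, "`κ_{k+1,k+1} > 0`").
At an INTEGER `r = s` the same scalar times `C(n, s)` is the genuine slice second moment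
`Σ_{|S|=s} p̂(S)²` (`JohnsonHarmonics.slice_sum_zeta_mul_zeta_eq`, already in the tree).

Consumer: cell pnp-psdrank (summit PneNP), eng MEMO-17 §5 (L1)/(P2) and lit LIT-40: the spectrum of the
matching-pulled-back knapsack functional relative to the cut-slice Gram is `λ_{k,d} = −μ_k · ℓᵀΓ⁻¹ℓ` with
`μ_k = c_k(t/2)` on `m = n/2` pair variables — this file is `μ_k` by name. Label: literature formalisation
(support / instrument); nothing here concerns psd rank of the matching polytope beyond that use, and nothing
concerns P vs NP. No instances, no notation, standard axioms.
-/

noncomputable section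

open Finset Polynomial
open scoped BigOperators
open Literature.Combinatorics.AssociationSchemes.JohnsonHarmonics

namespace Literature.Computability.Complexity

namespace KnapsackFormNonnegProof

variable {n : ℕ}

/-- **The knapsack form on one rung of a harmonic ladder** (Grigoriev's subspace
`C_{t+d−1}⋯C_t P_t^{(0)}`, PDF p. 9/15): for `p` harmonic of degree `t` and `2(t+d) ≤ n`,
`Q((Wᵀ)^d p)(r) = c_t(r) · ff(r − t, d)² · ⟪p,p⟫` — the single-term case of the Blekherman identity
`formPoly_eq_sosPoly`.
[cite: Grigoriev2001, §2 eq. (2.16) and the eigenspace description (PDF pp. 9, 15–16)]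
[cite: LeePrakashDewolfYuen2016, Thm. 2.4 (p. 7) and App. C (p. 23)] -/
theorem knapsackForm_iterate_up_of_isHarmonic {t d : ℕ} (htd : 2 * (t + d) ≤ n)
    {p : Finset (Fin n) → ℝ} (hp : IsHarmonic t p) (r : ℝ) :
    knapsackForm n r (up^[d] p) = (slicePoly n t).eval r * (ff (r - t) d) ^ 2 * ip p p := by
  classical
  -- the harmonic family with the single nonzero entry `p` at `(t, d)`
  set q : ℕ → ℕ → (Finset (Fin n) → ℝ) := fun t' d' => if t' = t ∧ d' = d then p else 0 with hq_def
  have hq_off : ∀ t' d', ¬ (t' = t ∧ d' = d) → q t' d' = 0 := fun t' d' h => by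
    simp [hq_def, h]
  have hq_on : q t d = p := by simp [hq_def]
  have hq : ∀ t' d', IsHarmonic t' (q t' d') := by
    intro t' d'
    by_cases h : t' = t ∧ d' = d
    · obtain ⟨rfl, rfl⟩ := h; rw [hq_on]; exact hp
    · rw [hq_off t' d' h]; exact IsHarmonic.zero _
  have hq0 : ∀ t' d', t + d < t' + d' → q t' d' = 0 := by
    intro t' d' hlt
    by_cases h : t' = t ∧ d' = d
    · obtain ⟨rfl, rfl⟩ := h; exact absurd hlt (lt_irrefl _)
    · exact hq_off t' d' h
  have ht_mem : t ∈ range (t + d + 1) := mem_range.2 (by omega)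
  have hd_mem : d ∈ range (t + d + 1) := mem_range.2 (by omega)
  have hdec : up^[d] p = ∑ t' ∈ range (t + d + 1), ∑ d' ∈ range (t + d + 1), up^[d'] (q t' d') := by
    rw [sum_eq_single_of_mem t ht_mem, sum_eq_single_of_mem d hd_mem, hq_on]
    · intro d' _ hd'
      rw [hq_off t d' (fun h => hd' h.2), iterate_up_zero_vec]
    · intro t' _ ht'
      exact sum_eq_zero fun d' _ => by rw [hq_off t' d' (fun h => ht' h.1), iterate_up_zero_vec]
  have hh : ∀ I, t + d < I.card → (up^[d] p) I = 0 :=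
    fun I hI => (isHomog_iterate_up hp.1 d) I (by omega)
  rw [← eval_formPoly, formPoly_eq_sosPoly htd hh hq hq0 hdec, eval_sosPoly,
    sum_eq_single_of_mem t ht_mem, sum_eq_single_of_mem d hd_mem, sum_eq_single_of_mem d hd_mem, hq_on]
  · ring
  · intro d' _ hd'
    rw [hq_off t d' (fun h => hd' h.2), ip_zero_right, mul_zero]
  · intro d₁ _ hd₁
    exact sum_eq_zero fun d' _ => by rw [hq_off t d₁ (fun h => hd₁ h.2), ip_zero_left, mul_zero]
  · intro t' _ ht'
    rw [sum_eq_zero fun d₁ _ => sum_eq_zero fun d' _ => by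
      rw [hq_off t' d₁ (fun h => ht' h.1), ip_zero_left, mul_zero], mul_zero]

/-- **Grigoriev's isotypic eigenvalue, eq. (2.16), by name.** For a harmonic coefficient vector `p` of
degree `k` (`2k ≤ n`) the knapsack moment form is the scalar `c_k(r) = (slicePoly n k).eval r` times
`⟪p,p⟫`: `Q` acts on the harmonic space `V_k ≅ S^{(n−k,k)}` as this scalar ("this eigenvalue depends only
on `k` and does not depend on a particular vector `u`", PDF p. 15).
[cite: Grigoriev2001, §2 eq. (2.16) (PDF p. 16)] [cite: LeePrakashDewolfYuen2016, Thm. 2.4 (p. 7), App. C (p. 23)] -/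
theorem knapsackForm_of_isHarmonic {k : ℕ} (hk : 2 * k ≤ n) {p : Finset (Fin n) → ℝ}
    (hp : IsHarmonic k p) (r : ℝ) :
    knapsackForm n r p = (slicePoly n k).eval r * ip p p := by
  have h := knapsackForm_iterate_up_of_isHarmonic (t := k) (d := 0) (by simpa using hk) hp r
  simpa using h

/-- The eigenvalue in product form: `Q(p) = ((n−2k)!/n!) · (r)_k · (n−r)_k · ⟪p,p⟫`
(`(x)_k = ff x k` the falling factorial), i.e. Grigoriev's (2.16)
`∏_{1≤j≤k}(r+1−j) · ∏ (n−r−…) / (n(n−1)⋯(n−2k+1))`.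
[cite: Grigoriev2001, §2 eq. (2.16) (PDF p. 16)] -/
theorem knapsackForm_of_isHarmonic_eq_prod {k : ℕ} (hk : 2 * k ≤ n) {p : Finset (Fin n) → ℝ}
    (hp : IsHarmonic k p) (r : ℝ) :
    knapsackForm n r p =
      ((n - 2 * k).factorial : ℝ) / n.factorial * (ff r k * ff ((n : ℝ) - r) k) * ip p p := by
  rw [knapsackForm_of_isHarmonic hk hp, eval_slicePoly]

/-- The factorial normalisation in the moments' currency: `((n−2k)!/n!)·(r)_k (n−r)_k = B_k(r; n)·B_k(n−r; n−k)`,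
i.e. `c_k(r) = knapsackMoment n r k · knapsackMoment (n − k) (n − r) k`.
[cite: Grigoriev2001, §1 (definition of B_k, PDF p. 8) and §2 eq. (2.16) (PDF p. 16)] -/
theorem eval_slicePoly_eq_knapsackMoment_mul {k : ℕ} (hk : 2 * k ≤ n) (r : ℝ) :
    (slicePoly n k).eval r = knapsackMoment n r k * knapsackMoment (n - k) ((n : ℝ) - r) k := by
  rw [eval_slicePoly, knapsackMoment_eq_ff_div, knapsackMoment_eq_ff_div, Nat.cast_sub (by omega)]
  -- `(n−2k)!/n! = 1/((n)_k (n−k)_k)` since `(n)_k (n−k)! = n!` and `(n−k)_k (n−2k)! = (n−k)!`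
  have h1 : ff (n : ℝ) k * ((n - k).factorial : ℝ) = (n.factorial : ℝ) := ff_natCast_mul_factorial (by omega)
  have h2 : ff ((n - k : ℕ) : ℝ) k * ((n - k - k).factorial : ℝ) = ((n - k).factorial : ℝ) :=
    ff_natCast_mul_factorial (by omega)
  have h2k : n - k - k = n - 2 * k := by omega
  rw [h2k] at h2
  have hcast : ((n - k : ℕ) : ℝ) = (n : ℝ) - k := Nat.cast_sub (by omega)
  rw [hcast] at h2
  have hn0 : (n.factorial : ℝ) ≠ 0 := by positivity
  have hf1 : ff (n : ℝ) k ≠ 0 := (ff_pos (by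
    have : (k : ℝ) ≤ n := by exact_mod_cast (show k ≤ n by omega)
    linarith)).ne'
  have hf2 : ff ((n : ℝ) - k) k ≠ 0 := (ff_pos (by
    have : (2 * k : ℕ) ≤ (n : ℝ) := by exact_mod_cast hk
    push_cast at this; linarith)).ne'
  have hfk : ((n - 2 * k).factorial : ℝ) ≠ 0 := by positivity
  -- clear denominators
  rw [div_mul_eq_mul_div, div_eq_iff hn0, div_mul_div_comm, div_mul_eq_mul_div, eq_comm,
    div_eq_iff (mul_ne_zero hf1 hf2)]
  calc ff r k * ff ((n : ℝ) - r) k * (n.factorial : ℝ)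
      = ff r k * ff ((n : ℝ) - r) k * (ff (n : ℝ) k * (ff ((n : ℝ) - k) k * ((n - 2 * k).factorial : ℝ))) := by
        rw [h2, h1]
    _ = ((n - 2 * k).factorial : ℝ) * (ff r k * ff ((n : ℝ) - r) k) * (ff (n : ℝ) k * ff ((n : ℝ) - k) k) := by
        ring

/-- Grigoriev's eigenvalue in the moments' currency: `Q(p) = B_k(r; n) · B_k(n − r; n − k) · ⟪p,p⟫` for
`p` harmonic of degree `k`, `2k ≤ n`.
[cite: Grigoriev2001, §2 eq. (2.16) (PDF p. 16)] -/
theorem knapsackForm_of_isHarmonic_eq_knapsackMoment {k : ℕ} (hk : 2 * k ≤ n) {p : Finset (Fin n) → ℝ}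
    (hp : IsHarmonic k p) (r : ℝ) :
    knapsackForm n r p = knapsackMoment n r k * knapsackMoment (n - k) ((n : ℝ) - r) k * ip p p := by
  rw [knapsackForm_of_isHarmonic hk hp, eval_slicePoly_eq_knapsackMoment_mul hk]

/-- `⟪p,p⟫ > 0` for `p ≠ 0`. [cite: LeePrakashDewolfYuen2016, App. B §B.3 (inner product; arXiv text chunk 20)] -/
theorem ip_self_pos {p : Finset (Fin n) → ℝ} (hp : p ≠ 0) : 0 < ip p p := by
  obtain ⟨S, hS⟩ : ∃ S, p S ≠ 0 := by
    by_contra h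
    push Not at h
    exact hp (funext h)
  unfold ip
  refine lt_of_lt_of_le (mul_self_pos.2 hS) ?_
  exact single_le_sum (f := fun T => p T * p T) (fun T _ => mul_self_nonneg (p T)) (mem_univ S)

/-- **Strict positivity in Grigoriev's window** (non-degeneracy of `Q_l` modulo the knapsack ideal,
"`κ_{k+1,k+1} > 0`", PDF p. 16): for `p ≠ 0` harmonic of degree `k`, `2k ≤ n`, and
`k − 1 < r < n − k + 1`, `Q(p) > 0`.
[cite: Grigoriev2001, Lemma 1.4 and §2 eq. (2.16) (PDF pp. 8, 16)] -/
theorem knapsackForm_pos_of_isHarmonic {k : ℕ} (hk : 2 * k ≤ n) {p : Finset (Fin n) → ℝ}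
    (hp : IsHarmonic k p) (hp0 : p ≠ 0) {r : ℝ} (h1 : (k : ℝ) - 1 < r) (h2 : r < (n : ℝ) - k + 1) :
    0 < knapsackForm n r p := by
  rw [knapsackForm_of_isHarmonic_eq_prod hk hp]
  refine mul_pos (mul_pos (by positivity) (mul_pos (ff_pos h1) (ff_pos (by linarith)))) (ip_self_pos hp0)

/-- The eigenvalue vanishes exactly at the excluded integers: for `p` harmonic of degree `k`, `2k ≤ n`, and
an integer `s < k`, `Q(p)(s) = 0` (the slice `C([n],s)` carries no `S^{(n−k,k)}` component).
[cite: Grigoriev2001, §2 (kernel of Q_l; PDF pp. 8–9)] -/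
theorem knapsackForm_of_isHarmonic_natCast_eq_zero {k s : ℕ} (hk : 2 * k ≤ n) (hs : s < k)
    {p : Finset (Fin n) → ℝ} (hp : IsHarmonic k p) :
    knapsackForm n (s : ℝ) p = 0 := by
  rw [knapsackForm_of_isHarmonic_eq_prod hk hp, ff_natCast_of_lt hs]
  simp

end KnapsackFormNonnegProof

end Literature.Computability.Complexity

end
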